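import Mathlib
import HarnessLib
import Summits.HubbardSuperconductivity.HubbardSuperconductivity.Theorems.KLProgrammeKLRegimeEngineKernelNormsWt4
import Summits.HubbardSuperconductivity.HubbardSuperconductivity.Theorems.KLProgrammeKLRegimeEngineV8DefsG7

/-!
# K3 ENGINE package, `Q`-level v7: the scale-`0` weighted-level constant `klWtT` and `klEngQ7 P R := (klEngQ6 P R).raiseCEOnly (klWtCE R)`
# (token #12 `klEngQ6 ↦ klEngQ7` of the 20437 engine-flow render, plan g17 (R44))

Cell `gate-hubbard-kl`, seat hubbard-kl-k3c2-p1 g4 (FINDING (Wt-KEY@j=0), KL STATUS 2026-08-27 l.2891; p3 g9 l.2894 independently; ruling (R44) l.2902).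

WHY.  Stub (b) `stub_engine_step_norms` of the engine-flow skeleton concludes, for EVERY internal level `j ≤ n` of the flow frame `K_n`,
`KernelNormsWt4 L M (klWtBudget P Q U j) β U μ K_n j`; at `j = 0` the budget reads `klWtBudget P Q U 0 (2p) = Q.CE^p·(Klam·|U|)^{p−1}`
(`klWtBudget_two_mul_of_two_le`, `epsCoupling P U 0 = Klam·|U|`).  The ONLY producer of scale-`0` weighted sums is the door-keyed (E1-W)₀ package
(p3 g8/g9, `…ScaleZeroKernelNormsWt{Package,Doors}`), whose degree-`2p` thresholds are `c_p·t^{2p}·(16e⁹κ₀²·klE4Abar R·|U|)^{p−2}·|U|` with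
`t = 2·klIsoT + C_T + 8(klE4X0 + 1)` CLOSED, `R`-FREE and NON-NUMERIC (`klIsoT`, `C_T`, `klE4X0` are `Classical.choose`/∃-witness terms) — so at
`Q = klEngQ6 P R` (`CE = klCE6 P R = 2^20·(klEngQ5 P R).CE`, numeral-or-`klE1CE P`) the inequality `32e⁹·t²·klE4Abar R ≤ Q.CE` that p3 g9's
`exists_kernelNormsWt4_zero_klWtBudget_klEng6` needs is UNPROVABLE.  Exactly as `klE1CE` (P-dependent) entered `klEngQ4.CE` and `klE4T6` entered
`klEngGeo7.cE4`, this file lets `CE` absorb the scale-`0` weighted constant (`Q` is chosen AFTER `R` in `EngineP4`'s `∃G ∀P ∀R ∃Q`, so an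
`R`-dependent `CE` is slot-legal), touching NO other field of `Q` (in particular `S'`, `CL`, `M0` are `rfl`-unchanged, so every two-leg reader
transfers as `Iff.rfl`):

* §1 **`EngConsts.raiseCEOnly Q ce := { Q with CE := max Q.CE ce }`** — `rfl` field rows, `raiseCEOnly_wf`, the monotone lifts of the two CE-readers
  (`kernelNormsV4_raiseCEOnly_of`, `klWtBudget_le_raiseCEOnly` / `kernelNormsWt4_klWtBudget_raiseCEOnly_of`) and the `Iff.rfl` doors of every
  other flow clause;
* §2 **`WtScaleZeroAt6 T`** (the door-keyed (E1-W)₀ admissibility = VERBATIM the body of p3 g9's export `exists_kernelNormsWt4_zero_klWtBudget_klEng6`,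
  `T` bound first), **`klWtT`** (classical `if` over `∃ T ≥ 0, WtScaleZeroAt6 T` — the `klE4T6` pattern: this Defs module does NOT import the
  analytic chain; the witness is routed in by the companion), `klWtT_nonneg`, `wtScaleZeroAt6_klWtT_of`;
  **`klWtCE R := 32 · e⁹ · klWtT² · klE4Abar R`** (p3 g9's threshold form, l.2894), `klWtCE_nonneg`;
* §3 **`klEngQ7 P R := (klEngQ6 P R).raiseCEOnly (klWtCE R)`**, `klEngQ7_wf`, `klEngQ7_CE`, `klWtCE_le_klEngQ7_CE`, `klEngQ6_CE_le_klEngQ7_CE`,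
  `klCE6_le_klEngQ7_CE`, `klE1CE_le_klEngQ7_CE`, `rfl` rows (`S'`, `CR`, `c0`, `cE4`, `Bf`, `SL`, `CL`, `L0`, `M0`), the instantiated doors
  `…_klEngQ7_iff` / `…_klEngQ7_of_klEngQ6`, and the CONSUMER form **`kernelNormsWt4_zero_klWtBudget_klEngQ7_of`**: from any witness `WtScaleZeroAt6 T`, stub (b)'s `j = 0` weighted
  level at `(klEngQ7, klEngC₃6, klEngU₀6)` for EVERY admissible frame `K` (`hCE := klWtCE_le_klEngQ7_CE`); the unconditional instance
  `kernelNormsWt4_zero_klWtBudget_klEngQ7` (witness = p3 g9's `exists_kernelNormsWt4_zero_klWtBudget_klEng6`) is in the companion.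

NOT provided (false by monotonicity): lifts of `TwoLegStepV17F2` as a whole or of `HistP klPredsV17F2 … (klEngQ7 P R) …` hypotheses from their
`klEngQ6` versions — a `klEngQ7`-history differs from its `klEngQ6` twin EXACTLY in the (E1-v4) conjuncts (`engineBoundsAtV17F2_klEngQ7_iff_of_E1`).
Registrant token #12: `klEngQ6 ↦ klEngQ7` (+ `klEngQ6_wf ↦ klEngQ7_wf`, this import).  Definitions with bodies + order lemmas only; nothing about
the model is asserted; nothing asserts superconductivity.
-/

noncomputable section

/-! ## §1 `EngConsts.raiseCEOnly` — raising the tree-expansion constant alone -/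

namespace Summit.HubbardSuperconductivity.HubbardSuperconductivity.Theorems.KLRegimeSplit

set_option linter.dupNamespace false -- summit = problem name (single-conjunct summit), D-0017

open Real Finset Literature.MathematicalPhysics.QuantumLattice Literature.Probability.LatticeModels
open Summit.HubbardSuperconductivity.HubbardSuperconductivity.Theorems.KLProgrammeLegKernels
open Summit.HubbardSuperconductivity.HubbardSuperconductivity.Theorems.EngineV8

/-- **`Q.raiseCEOnly ce`** — the engine package `Q` with `CE := max Q.CE ce`, EVERY other field (in particular `S'`) untouched. -/
def EngConsts.raiseCEOnly (Q : EngConsts) (ce : ℝ) : EngConsts :=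
  { Q with CE := max Q.CE ce }

namespace EngConsts

variable (Q : EngConsts) (ce : ℝ)

/-- `(Q.raiseCEOnly ce).CE = max Q.CE ce`. -/
theorem raiseCEOnly_CE : (Q.raiseCEOnly ce).CE = max Q.CE ce := rfl
/-- untouched field `CR`. -/
theorem raiseCEOnly_CR : (Q.raiseCEOnly ce).CR = Q.CR := rfl
/-- untouched field `c0`. -/
theorem raiseCEOnly_c0 : (Q.raiseCEOnly ce).c0 = Q.c0 := rfl
/-- untouched field `cE4`. -/
theorem raiseCEOnly_cE4 : (Q.raiseCEOnly ce).cE4 = Q.cE4 := rfl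
/-- untouched field `S'`. -/
theorem raiseCEOnly_S' : (Q.raiseCEOnly ce).S' = Q.S' := rfl
/-- untouched field `Bf`. -/
theorem raiseCEOnly_Bf : (Q.raiseCEOnly ce).Bf = Q.Bf := rfl
/-- untouched field `SL`. -/
theorem raiseCEOnly_SL : (Q.raiseCEOnly ce).SL = Q.SL := rfl
/-- untouched field `CL`. -/
theorem raiseCEOnly_CL : (Q.raiseCEOnly ce).CL = Q.CL := rfl
/-- untouched field `L0`. -/
theorem raiseCEOnly_L0 : (Q.raiseCEOnly ce).L0 = Q.L0 := rfl
/-- untouched field `M0`. -/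
theorem raiseCEOnly_M0 : (Q.raiseCEOnly ce).M0 = Q.M0 := rfl

/-- `Q.CE ≤ (Q.raiseCEOnly ce).CE`. -/
theorem CE_le_raiseCEOnly_CE : Q.CE ≤ (Q.raiseCEOnly ce).CE := le_max_left _ _
/-- `ce ≤ (Q.raiseCEOnly ce).CE`. -/
theorem le_raiseCEOnly_CE : ce ≤ (Q.raiseCEOnly ce).CE := le_max_right _ _

variable {Q}

/-- **Raising `CE` preserves well-formedness** (`CE` enters `EngConsts.WF` only through `0 ≤ CE`). -/
theorem raiseCEOnly_wf (hQ : Q.WF) (ce : ℝ) : (Q.raiseCEOnly ce).WF := by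
  obtain ⟨h1, h2, h3, h4, h5, h6, h7, h8⟩ := hQ
  exact ⟨h1.trans (le_max_left _ _), h2, h3, h4, h5, h6, h7, h8⟩

end EngConsts

/-! ### The majorants and slot clauses under `raiseCEOnly` -/

section Bars

variable (G : GeoConsts) (P : SplitConsts) (Q : EngConsts) (ce : ℝ)

/-- `legDressBarQ2` reads only `CR`. -/
theorem legDressBarQ2_raiseCEOnly (U : ℝ) (n c : ℕ) : legDressBarQ2 G P (Q.raiseCEOnly ce) U n c = legDressBarQ2 G P Q U n c := rfl
/-- `eremBar` reads only `CR`, `CL`. -/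
theorem eremBar_raiseCEOnly (U β : ℝ) (L n : ℕ) : eremBar G P (Q.raiseCEOnly ce) U β L n = eremBar G P Q U β L n := rfl
/-- `frameShiftBar` reads only `CR`. -/
theorem frameShiftBar_raiseCEOnly (U : ℝ) (n : ℕ) : frameShiftBar P (Q.raiseCEOnly ce) U n = frameShiftBar P Q U n := rfl
/-- `twoLegBar` reads only `S'`. -/
theorem twoLegBar_raiseCEOnly (U : ℝ) (j n : ℕ) : twoLegBar G (Q.raiseCEOnly ce) U j n = twoLegBar G Q U j n := rfl

/-- **The (E1-W) budget is monotone in `CE`** (`0 ≤ Q.CE`, `0 ≤ P.Klam`). -/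
theorem klWtBudget_le_raiseCEOnly (hCE : 0 ≤ Q.CE) (hK : 0 ≤ P.Klam) (U : ℝ) (j m : ℕ) :
    klWtBudget P Q U j m ≤ klWtBudget P (Q.raiseCEOnly ce) U j m := by
  rw [klWtBudget_def, klWtBudget_def, EngConsts.raiseCEOnly_CE]
  have hε := epsCoupling_nonneg' hK U j
  have h2 : 0 ≤ epsCoupling P U j ^ max 1 (m / 2 - 1) * (2 : ℝ) ^ ((3 * ((m / 2 : ℕ) : ℤ) - 5) * j) :=
    mul_nonneg (pow_nonneg hε _) (zpow_nonneg (by norm_num) _)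
  have hpow : Q.CE ^ (m / 2) ≤ (max Q.CE ce) ^ (m / 2) := pow_le_pow_left₀ hCE (le_max_left _ _) _
  calc Q.CE ^ (m / 2) * epsCoupling P U j ^ max 1 (m / 2 - 1) * (2 : ℝ) ^ ((3 * ((m / 2 : ℕ) : ℤ) - 5) * j)
      = Q.CE ^ (m / 2) * (epsCoupling P U j ^ max 1 (m / 2 - 1) * (2 : ℝ) ^ ((3 * ((m / 2 : ℕ) : ℤ) - 5) * j)) := by ring
    _ ≤ (max Q.CE ce) ^ (m / 2) * (epsCoupling P U j ^ max 1 (m / 2 - 1) * (2 : ℝ) ^ ((3 * ((m / 2 : ℕ) : ℤ) - 5) * j)) :=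
        mul_le_mul_of_nonneg_right hpow h2
    _ = _ := by ring

end Bars

section Model

variable {L M : ℕ} [NeZero L] [NeZero M] {G : GeoConsts} {P : SplitConsts} {Q : EngConsts} {R : RenConsts} {β U μ : ℝ}
  {K : TrigPolyC4v} {n : ℕ} (ce : ℝ)

omit [NeZero M] in
/-- **(E1-v4) lifts along `raiseCEOnly`** (`Q.WF`, `0 ≤ P.Klam`; monotone in `CE`). -/
theorem kernelNormsV4_raiseCEOnly_of (hQ : Q.WF) (hK : 0 ≤ P.Klam) (h : KernelNormsV4 L M P Q β U μ K n) :
    KernelNormsV4 L M P (Q.raiseCEOnly ce) β U μ K n := by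
  intro p hp
  refine (h p hp).trans ?_
  have hε : 0 ≤ epsCoupling P U n := epsCoupling_nonneg' hK U n
  have hCE : Q.CE ^ p ≤ (Q.raiseCEOnly ce).CE ^ p := pow_le_pow_left₀ hQ.1 (EngConsts.CE_le_raiseCEOnly_CE Q ce) p
  have h2 : 0 ≤ (epsCoupling P U n) ^ (p - 1) * (2 : ℝ) ^ ((3 * (p : ℤ) - 5) * n) :=
    mul_nonneg (pow_nonneg hε _) (zpow_nonneg (by norm_num) _)
  calc Q.CE ^ p * (epsCoupling P U n) ^ (p - 1) * (2 : ℝ) ^ ((3 * (p : ℤ) - 5) * n)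
      = Q.CE ^ p * ((epsCoupling P U n) ^ (p - 1) * (2 : ℝ) ^ ((3 * (p : ℤ) - 5) * n)) := by ring
    _ ≤ (Q.raiseCEOnly ce).CE ^ p * ((epsCoupling P U n) ^ (p - 1) * (2 : ℝ) ^ ((3 * (p : ℤ) - 5) * n)) :=
        mul_le_mul_of_nonneg_right hCE h2
    _ = _ := by ring

omit [NeZero M] in
/-- **The weighted levels at the (E1-W) budget lift along `raiseCEOnly`** (`Q.WF`, `0 ≤ P.Klam`). -/
theorem kernelNormsWt4_klWtBudget_raiseCEOnly_of (hQ : Q.WF) (hK : 0 ≤ P.Klam) {j : ℕ}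
    (h : KernelNormsWt4 L M (klWtBudget P Q U j) β U μ K j) : KernelNormsWt4 L M (klWtBudget P (Q.raiseCEOnly ce) U j) β U μ K j :=
  h.mono fun m => klWtBudget_le_raiseCEOnly P Q ce hQ.1 hK U j m

/-- `KernelNormsLevels` at the budget-free form does not read `CE`?  It does (its law is `CE`-scaled) — lift it monotonically when a consumer asks;
here only the clauses of the flow SLOT are treated.  (E2-F2) is unchanged by `raiseCEOnly` (reads `CR`, `CL`). -/
theorem pairLadderStepAtV17F2_raiseCEOnly_iff :
    PairLadderStepAtV17F2 L M G P (Q.raiseCEOnly ce) β U μ n ↔ PairLadderStepAtV17F2 L M G P Q β U μ n := Iff.rfl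

/-- (E2″-F) is unchanged by `raiseCEOnly`. -/
theorem pairValueIncrementAtV17F_raiseCEOnly_iff :
    PairValueIncrementAtV17F L M G P (Q.raiseCEOnly ce) β U μ n ↔ PairValueIncrementAtV17F L M G P Q β U μ n := Iff.rfl

/-- (E2′-F) is unchanged by `raiseCEOnly`. -/
theorem quarticValueIncrementAtV17F_raiseCEOnly_iff :
    QuarticValueIncrementAtV17F L M G P (Q.raiseCEOnly ce) β U μ n ↔ QuarticValueIncrementAtV17F L M G P Q β U μ n := Iff.rfl

/-- (E2′-F UV) is unchanged by `raiseCEOnly`. -/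
theorem quarticValueUVAtV17F_raiseCEOnly_iff :
    QuarticValueUVAtV17F L M G P (Q.raiseCEOnly ce) β U μ n ↔ QuarticValueUVAtV17F L M G P Q β U μ n := Iff.rfl

/-- (E4) is unchanged by `raiseCEOnly` (reads `Q.cE4`). -/
theorem engineFirstMoments_raiseCEOnly_iff :
    EngineFirstMoments L M G P (Q.raiseCEOnly ce) β U μ K n ↔ EngineFirstMoments L M G P Q β U μ K n := Iff.rfl

/-- The split slot is unchanged by `raiseCEOnly` (reads `Q.CR`). -/
theorem betaSplitAtV17F_raiseCEOnly_iff :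
    BetaSplitAtV17F L M G P (Q.raiseCEOnly ce) β U μ n ↔ BetaSplitAtV17F L M G P Q β U μ n := Iff.rfl

/-- (E3a-F) is unchanged by `raiseCEOnly` (reads `Q.S'`, untouched). -/
theorem twoLegReadJetsF_raiseCEOnly_iff :
    TwoLegReadJetsF L M G (Q.raiseCEOnly ce) β U μ n ↔ TwoLegReadJetsF L M G Q β U μ n := Iff.rfl

/-- **The cured engine slot lifts along `raiseCEOnly`** (`Q.WF`, `0 ≤ P.Klam`): only its (E1-v4) conjunct moves, monotonically. -/
theorem engineBoundsAtV17F2_raiseCEOnly_of (hQ : Q.WF) (hK : 0 ≤ P.Klam) (h : EngineBoundsAtV17F2 L M G P Q β U μ n) :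
    EngineBoundsAtV17F2 L M G P (Q.raiseCEOnly ce) β U μ n := by
  obtain ⟨h0, h1, h2, h3, h4, h5, h6, h7⟩ := h
  exact ⟨h0, kernelNormsV4_raiseCEOnly_of ce hQ hK h1, h2, h3, h4, h5, h6, h7⟩

/-- **At the raised package the engine slot is the unraised one with (E1-v4) re-read at the larger `CE`.** -/
theorem engineBoundsAtV17F2_raiseCEOnly_iff_of_E1 :
    EngineBoundsAtV17F2 L M G P (Q.raiseCEOnly ce) β U μ n ↔
      (SelfEnergySymmetric L M β U μ (klFlowFrameU L M β U μ n) n ∧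
        KernelNormsV4 L M P (Q.raiseCEOnly ce) β U μ (klFlowFrameU L M β U μ n) n ∧
          PairLadderStepAtV17F2 L M G P Q β U μ n ∧ PairValueIncrementAtV17F L M G P Q β U μ n ∧
            QuarticValueIncrementAtV17F L M G P Q β U μ n ∧ QuarticValueUVAtV17F L M G P Q β U μ n ∧
              EngineFirstMoments L M G P Q β U μ (klFlowFrameU L M β U μ n) n ∧ IsoTupleL1AtV17F L M G P β U μ n) :=
  Iff.rfl

end Model

end Summit.HubbardSuperconductivity.HubbardSuperconductivity.Theorems.KLRegimeSplit

namespace Summit.HubbardSuperconductivity.HubbardSuperconductivity.Theorems.EngineV8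

set_option linter.dupNamespace false -- summit = problem name (single-conjunct summit), D-0017

open Real Finset Literature.MathematicalPhysics.QuantumLattice Literature.Probability.LatticeModels
open Summit.HubbardSuperconductivity.HubbardSuperconductivity.Theorems.KLRegimeSplit
open Summit.HubbardSuperconductivity.HubbardSuperconductivity.Theorems.KLProgrammeLegKernels

/-! ## §2 The door-keyed (E1-W)₀ admissibility `WtScaleZeroAt6`, the constant `klWtT` and the threshold `klWtCE` -/

/-- **`WtScaleZeroAt6 T`** — `T` is an admissible scale-`0` weighted-level constant UNDER THE DOORS: for every `P R`, every engine package `Q` with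
`32·e⁹·T²·klE4Abar R ≤ Q.CE`, the binders of the engine-flow stubs (`c ≤ klEngC₃6 P R`, `U ≤ klEngU₀6 P R c`), every admissible frame `K` and
the volumes above `klEngL₃ / klEngM₃`: `KernelNormsWt4 L M (klWtBudget P Q U 0) β U μ K 0` — VERBATIM the body of p3 g9's export
`exists_kernelNormsWt4_zero_klWtBudget_klEng6` (`…ScaleZeroKernelNormsWtDoors`), so that `∃ T ≥ 0, WtScaleZeroAt6 T` IS that theorem.
WITNESS SHAPE: `T` is bound FIRST — a closed absolute term (p3's `2·klIsoT + C_T + 8(klE4X0+1)`); `R` enters only through `klE4Abar R`. -/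
def WtScaleZeroAt6 (T : ℝ) : Prop :=
  ∀ (P : SplitConsts) (R : RenConsts) (Q : EngConsts) (c : ℝ), P.WF → R.WF2 →
    32 * Real.exp 1 ^ 9 * T ^ 2 * klE4Abar R ≤ Q.CE → 0 < c → c ≤ klEngC₃6 P R →
    ∀ μ ∈ klWindowC, ∀ U : ℝ, 0 < U → U ≤ klEngU₀6 P R c →
    ∀ β : ℝ, klBetaMin ≤ β → β ≤ Real.exp (c / U ^ 2) → ∀ K : TrigPolyC4v, FrameOK R U (nScales β) μ K →
    ∀ (L M : ℕ) [NeZero L] [NeZero M], klEngL₃ β U ≤ L → klEngM₃ β U L ≤ M →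
      KernelNormsWt4 L M (klWtBudget P Q U 0) β U μ K 0

open Classical in
/-- **`klWtT`** — THE scale-`0` weighted-level constant of the engine: a nonnegative admissible `T` when one exists, `0` otherwise (classical `if`,
a CLOSED term — the `klE4T`/`klE4T6` pattern, so this Defs module does not import the analytic chain; the witness is p3 g9's export, routed in
by `wtScaleZeroAt6_klWtT` in the companion `…ScaleZeroV17FG7Q7U9`). -/
def klWtT : ℝ := if h : (∃ T : ℝ, 0 ≤ T ∧ WtScaleZeroAt6 T) then Classical.choose h else 0

/-- `0 ≤ klWtT`. -/
theorem klWtT_nonneg : 0 ≤ klWtT := by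
  classical
  unfold klWtT
  split_ifs with h
  · exact (Classical.choose_spec h).1
  · exact le_rfl

/-- **`klWtT` is admissible as soon as any nonnegative constant is.** -/
theorem wtScaleZeroAt6_klWtT_of {T : ℝ} (hT0 : 0 ≤ T) (hT : WtScaleZeroAt6 T) : WtScaleZeroAt6 klWtT := by
  classical
  have h : ∃ T : ℝ, 0 ≤ T ∧ WtScaleZeroAt6 T := ⟨T, hT0, hT⟩
  have : klWtT = Classical.choose h := by unfold klWtT; exact dif_pos h
  rw [this]
  exact (Classical.choose_spec h).2

/-- **`klWtCE R := 32 · e⁹ · klWtT² · klE4Abar R`** — the `CE`-threshold under which the scale-`0` weighted levels sit inside the (E1-W) budget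
(p3 g9's form, KL STATUS l.2894; `R`-dependent through `klE4Abar R`, closed). -/
def klWtCE (R : RenConsts) : ℝ := 32 * Real.exp 1 ^ 9 * klWtT ^ 2 * klE4Abar R

/-- `0 ≤ klWtCE R`. -/
theorem klWtCE_nonneg (R : RenConsts) : 0 ≤ klWtCE R := by
  have := klE4Abar_pos R
  unfold klWtCE; positivity

/-! ## §3 The package `klEngQ7` -/

/-- **`klEngQ7 P R` — the engine-flow package's `Q`, v7**: `klEngQ6 P R` with `CE := max (klEngQ6 P R).CE (klWtCE R)`, NOTHING else moved. -/
def klEngQ7 (P : SplitConsts) (R : RenConsts) : EngConsts := (klEngQ6 P R).raiseCEOnly (klWtCE R)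

/-- `klEngQ7 P R = (klEngQ6 P R).raiseCEOnly (klWtCE R)` (`rfl`). -/
theorem klEngQ7_eq (P : SplitConsts) (R : RenConsts) : klEngQ7 P R = (klEngQ6 P R).raiseCEOnly (klWtCE R) := rfl

/-- **`klEngQ7 P R` is well formed.** -/
theorem klEngQ7_wf (P : SplitConsts) (R : RenConsts) : (klEngQ7 P R).WF := EngConsts.raiseCEOnly_wf (klEngQ6_wf P R) _

/-- `(klEngQ7 P R).CE = max (klEngQ6 P R).CE (klWtCE R)`. -/
theorem klEngQ7_CE (P : SplitConsts) (R : RenConsts) : (klEngQ7 P R).CE = max (klEngQ6 P R).CE (klWtCE R) := rfl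

/-- **`klWtCE R ≤ (klEngQ7 P R).CE`** — the `hCE` input of the scale-`0` weighted-level consumer at the v7 package. -/
theorem klWtCE_le_klEngQ7_CE (P : SplitConsts) (R : RenConsts) : klWtCE R ≤ (klEngQ7 P R).CE := le_max_right _ _

/-- `(klEngQ6 P R).CE ≤ (klEngQ7 P R).CE`. -/
theorem klEngQ6_CE_le_klEngQ7_CE (P : SplitConsts) (R : RenConsts) : (klEngQ6 P R).CE ≤ (klEngQ7 P R).CE := le_max_left _ _

/-- `klCE6 P R ≤ (klEngQ7 P R).CE` (the v6 table rides). -/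
theorem klCE6_le_klEngQ7_CE (P : SplitConsts) (R : RenConsts) : klCE6 P R ≤ (klEngQ7 P R).CE :=
  (klCE6_le_klEngQ6_CE P R).trans (klEngQ6_CE_le_klEngQ7_CE P R)

/-- `(klEngQ5 P R).CE ≤ (klEngQ7 P R).CE`. -/
theorem klEngQ5_CE_le_klEngQ7_CE (P : SplitConsts) (R : RenConsts) : (klEngQ5 P R).CE ≤ (klEngQ7 P R).CE :=
  (klEngQ5_CE_le_klEngQ6_CE P R).trans (klEngQ6_CE_le_klEngQ7_CE P R)

/-- `klE1CE P ≤ (klEngQ7 P R).CE` (the (E1-v4)₀ threshold rides). -/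
theorem klE1CE_le_klEngQ7_CE (P : SplitConsts) (R : RenConsts) : klE1CE P ≤ (klEngQ7 P R).CE :=
  (klE1CE_le_klEngQ5_CE P R).trans (klEngQ5_CE_le_klEngQ7_CE P R)

/-- untouched field `S'` (`rfl`: `raiseCEOnly` does not touch the two-leg slacks). -/
theorem klEngQ7_S' (P : SplitConsts) (R : RenConsts) : (klEngQ7 P R).S' = (klEngQ6 P R).S' := rfl
/-- untouched field `CR`. -/
theorem klEngQ7_CR (P : SplitConsts) (R : RenConsts) : (klEngQ7 P R).CR = (klEngQ6 P R).CR := rfl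
/-- untouched field `c0`. -/
theorem klEngQ7_c0 (P : SplitConsts) (R : RenConsts) : (klEngQ7 P R).c0 = (klEngQ6 P R).c0 := rfl
/-- untouched field `cE4`. -/
theorem klEngQ7_cE4 (P : SplitConsts) (R : RenConsts) : (klEngQ7 P R).cE4 = (klEngQ6 P R).cE4 := rfl
/-- untouched field `Bf`. -/
theorem klEngQ7_Bf (P : SplitConsts) (R : RenConsts) : (klEngQ7 P R).Bf = (klEngQ6 P R).Bf := rfl
/-- untouched field `SL`. -/
theorem klEngQ7_SL (P : SplitConsts) (R : RenConsts) : (klEngQ7 P R).SL = (klEngQ6 P R).SL := rfl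
/-- untouched field `CL`. -/
theorem klEngQ7_CL (P : SplitConsts) (R : RenConsts) : (klEngQ7 P R).CL = (klEngQ6 P R).CL := rfl
/-- untouched field `L0`. -/
theorem klEngQ7_L0 (P : SplitConsts) (R : RenConsts) : (klEngQ7 P R).L0 = (klEngQ6 P R).L0 := rfl
/-- untouched field `M0`. -/
theorem klEngQ7_M0 (P : SplitConsts) (R : RenConsts) : (klEngQ7 P R).M0 = (klEngQ6 P R).M0 := rfl

/-- `deltaUV` absorption rides to v7 (`CR` untouched). -/
theorem deltaUV_absorbed7 (P : SplitConsts) (R : RenConsts) : 32 * R.Gfr 0 + 4 * R.cr ≤ (klEngQ7 P R).CR := deltaUV_absorbed5 P R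

/-! ### The instantiated doors `klEngQ6 ⟷ klEngQ7` -/

section Model

variable {L M : ℕ} [NeZero L] [NeZero M] {G : GeoConsts} {P : SplitConsts} {R : RenConsts} {β U μ : ℝ} {K : TrigPolyC4v} {n : ℕ}

/-- (E2-F2) at `klEngQ7` IS (E2-F2) at `klEngQ6`. -/
theorem pairLadderStepAtV17F2_klEngQ7_iff :
    PairLadderStepAtV17F2 L M G P (klEngQ7 P R) β U μ n ↔ PairLadderStepAtV17F2 L M G P (klEngQ6 P R) β U μ n := Iff.rfl
/-- (E2″-F) at `klEngQ7` IS (E2″-F) at `klEngQ6`. -/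
theorem pairValueIncrementAtV17F_klEngQ7_iff :
    PairValueIncrementAtV17F L M G P (klEngQ7 P R) β U μ n ↔ PairValueIncrementAtV17F L M G P (klEngQ6 P R) β U μ n := Iff.rfl
/-- (E2′-F) at `klEngQ7` IS (E2′-F) at `klEngQ6`. -/
theorem quarticValueIncrementAtV17F_klEngQ7_iff :
    QuarticValueIncrementAtV17F L M G P (klEngQ7 P R) β U μ n ↔ QuarticValueIncrementAtV17F L M G P (klEngQ6 P R) β U μ n := Iff.rfl
/-- (E2′-F UV) at `klEngQ7` IS (E2′-F UV) at `klEngQ6`. -/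
theorem quarticValueUVAtV17F_klEngQ7_iff :
    QuarticValueUVAtV17F L M G P (klEngQ7 P R) β U μ n ↔ QuarticValueUVAtV17F L M G P (klEngQ6 P R) β U μ n := Iff.rfl
/-- (E4) at `klEngQ7` IS (E4) at `klEngQ6`. -/
theorem engineFirstMoments_klEngQ7_iff :
    EngineFirstMoments L M G P (klEngQ7 P R) β U μ K n ↔ EngineFirstMoments L M G P (klEngQ6 P R) β U μ K n := Iff.rfl
/-- The split slot at `klEngQ7` IS the split slot at `klEngQ6`. -/
theorem betaSplitAtV17F_klEngQ7_iff :
    BetaSplitAtV17F L M G P (klEngQ7 P R) β U μ n ↔ BetaSplitAtV17F L M G P (klEngQ6 P R) β U μ n := Iff.rfl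
/-- (E3a-F) at `klEngQ7` IS (E3a-F) at `klEngQ6` (`S'` untouched). -/
theorem twoLegReadJetsF_klEngQ7_iff :
    TwoLegReadJetsF L M G (klEngQ7 P R) β U μ n ↔ TwoLegReadJetsF L M G (klEngQ6 P R) β U μ n := Iff.rfl

omit [NeZero M] in
/-- **(E1-v4) lifts `klEngQ6 → klEngQ7`** (`P.WF`). -/
theorem kernelNormsV4_klEngQ7_of_klEngQ6 (hP : P.WF) (h : KernelNormsV4 L M P (klEngQ6 P R) β U μ K n) :
    KernelNormsV4 L M P (klEngQ7 P R) β U μ K n :=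
  kernelNormsV4_raiseCEOnly_of (klWtCE R) (klEngQ6_wf P R) (zero_le_one.trans hP.1) h

omit [NeZero M] in
/-- **The weighted levels at the (E1-W) budget lift `klEngQ6 → klEngQ7`** (`P.WF`). -/
theorem kernelNormsWt4_klWtBudget_klEngQ7_of_klEngQ6 (hP : P.WF) {j : ℕ}
    (h : KernelNormsWt4 L M (klWtBudget P (klEngQ6 P R) U j) β U μ K j) :
    KernelNormsWt4 L M (klWtBudget P (klEngQ7 P R) U j) β U μ K j :=
  kernelNormsWt4_klWtBudget_raiseCEOnly_of (klWtCE R) (klEngQ6_wf P R) (zero_le_one.trans hP.1) h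

/-- **The cured engine slot lifts `klEngQ6 → klEngQ7`** (`P.WF`). -/
theorem engineBoundsAtV17F2_klEngQ7_of_klEngQ6 (hP : P.WF) (h : EngineBoundsAtV17F2 L M G P (klEngQ6 P R) β U μ n) :
    EngineBoundsAtV17F2 L M G P (klEngQ7 P R) β U μ n :=
  engineBoundsAtV17F2_raiseCEOnly_of (klWtCE R) (klEngQ6_wf P R) (zero_le_one.trans hP.1) h

/-- **What a `klEngQ7` engine slot gives a `klEngQ6`-keyed consumer**: every conjunct except (E1-v4) verbatim at `klEngQ6`. -/
theorem engineBoundsAtV17F2_klEngQ7_iff_of_E1 :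
    EngineBoundsAtV17F2 L M G P (klEngQ7 P R) β U μ n ↔
      (SelfEnergySymmetric L M β U μ (klFlowFrameU L M β U μ n) n ∧
        KernelNormsV4 L M P (klEngQ7 P R) β U μ (klFlowFrameU L M β U μ n) n ∧
          PairLadderStepAtV17F2 L M G P (klEngQ6 P R) β U μ n ∧ PairValueIncrementAtV17F L M G P (klEngQ6 P R) β U μ n ∧
            QuarticValueIncrementAtV17F L M G P (klEngQ6 P R) β U μ n ∧ QuarticValueUVAtV17F L M G P (klEngQ6 P R) β U μ n ∧
              EngineFirstMoments L M G P (klEngQ6 P R) β U μ (klFlowFrameU L M β U μ n) n ∧ IsoTupleL1AtV17F L M G P β U μ n) :=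
  Iff.rfl

/-- **The CONSUMER form: stub (b)'s `j = 0` weighted level at the v7 package, for EVERY admissible frame**, from ANY witness
`WtScaleZeroAt6 T` (`0 ≤ T`; the companion `…ScaleZeroV17FG7Q7U9` supplies p3 g9's): under the binders of the engine-flow stubs
(`c ≤ klEngC₃6 P R`, `U ≤ klEngU₀6 P R c`) and any `K` with `FrameOK R U (nScales β) μ K` (e.g. the flow frame `K_n`),
`KernelNormsWt4 L M (klWtBudget P (klEngQ7 P R) U 0) β U μ K 0` (`hCE := klWtCE_le_klEngQ7_CE`). -/
theorem kernelNormsWt4_zero_klWtBudget_klEngQ7_of {T : ℝ} (hT0 : 0 ≤ T) (hT : WtScaleZeroAt6 T) (P : SplitConsts) (R : RenConsts)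
    (c : ℝ) (hP : P.WF) (hR : R.WF2) (hc : 0 < c) (hc₆ : c ≤ klEngC₃6 P R) (μ : ℝ) (hμ : μ ∈ klWindowC) (U : ℝ) (hU : 0 < U)
    (hU₀ : U ≤ klEngU₀6 P R c) (β : ℝ) (hβ : klBetaMin ≤ β) (hβc : β ≤ Real.exp (c / U ^ 2)) (K : TrigPolyC4v)
    (hK : FrameOK R U (nScales β) μ K) (L M : ℕ) [NeZero L] [NeZero M] (hL : klEngL₃ β U ≤ L) (hM : klEngM₃ β U L ≤ M) :
    KernelNormsWt4 L M (klWtBudget P (klEngQ7 P R) U 0) β U μ K 0 :=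
  wtScaleZeroAt6_klWtT_of hT0 hT P R (klEngQ7 P R) c hP hR (klWtCE_le_klEngQ7_CE P R) hc hc₆ μ hμ U hU hU₀ β hβ hβc K hK L M hL hM

end Model

end Summit.HubbardSuperconductivity.HubbardSuperconductivity.Theorems.EngineV8

end
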